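import Summits.ResolutionOfSingularities.ResolutionOfSingularities.Theorems.WeightedInvariantHypersurfaceCentreAlgebraize
import Summits.ResolutionOfSingularities.ResolutionOfSingularities.Theorems.WeightedInvariantWeightedConstructionWeightedChartBasicOpen
import HarnessLib

/-!
# Door H2b (ALGEBRAIZE) — a regular weighted centre from charts checked at the base point only

Route `ResolutionOfSingularities/WeightedInvariant`, crux `Theses.WeightedInvariant.HypersurfaceCentreConstruction`
(stmt-ResolutionOfSingularities-19897), door line `local-engine`, CRUX-PLAN §v6.2 H2b (seat res-L1-w43-stub-9 = res-D-brk-1):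
sequel of `Theorems/WeightedInvariantHypersurfaceCentreAlgebraize.lean`. Włodarczyk's condition 2.1.10 for a Rees algebra `R` to be
a regular weighted centre asks, chart by chart, that the parameters be part of a regular system of parameters at EVERY point of
their common zero locus. Over a perfect field (regular stalks, locally of finite type) it suffices to check this AT ONE POINT per
chart: `isRegularWeightedCentre_of_forall_exists_chart_at` (and `_of_smooth`). Def-free helper (`--supports
stmt-ResolutionOfSingularities-19897`); nothing here is a claim about Hironaka's problem, no regular weighted centre is asserted to exist.
-/

noncomputable section

set_option linter.dupNamespace false -- mandated namespace of this single-conjunct summit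

namespace Summit.ResolutionOfSingularities.ResolutionOfSingularities.Theorems

open CategoryTheory AlgebraicGeometry TopologicalSpace IsLocalRing
open Literature.AlgebraicGeometry.Resolution

/-! ## A4. Regular weighted centres from charts checked at the base point only -/

section Centre

universe u

/-- **A Rees algebra with locally weighted-monomial pieces, in parameters independent at the base point, is a regular
weighted centre.** Let `Y` be locally of finite type over a perfect field with regular local rings, `R` a Rees algebra on
`Y`, and suppose every point `y` has an affine neighbourhood `U`, sections `u₁, …, u_m ∈ Γ(Y, U)` and positive weights `w`
with `Rₙ(U) = (u^α : Σ wᵢ αᵢ ≥ n)` for all `n`, such that IF all `uᵢ` vanish at `y` then their differentials at `y` are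
linearly independent. Then `R.IsRegularWeightedCentre` (Włodarczyk 2.1.10): near a point of `V(u)` the chart `(U, u, w)`
shrinks to a weighted chart by `exists_affineOpens_isWeightedChart_of_linearIndependent`; near a point off `V(u)` some
`uᵢ` is a unit on `U ∩ D(uᵢ)`, where every piece is the unit ideal and the unit chart serves. This removes the clause
«at EVERY point of `V(u) ∩ U`» from what a globalization of local moves has to verify. [cite: Wlodarczyk2022, 2.1.10] -/
theorem isRegularWeightedCentre_of_forall_exists_chart_at {k : Type u} [Field k] [PerfectField k]
    {Y : Scheme.{u}} (f : Y ⟶ Spec (.of k)) [LocallyOfFiniteType f]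
    (hreg : ∀ y : Y, IsRegularLocalRing (Y.presheaf.stalk y)) (R : ReesAlgebraData Y)
    (h : ∀ y : Y, ∃ (U : Y.affineOpens) (hy : y ∈ (U : Y.Opens)) (m : ℕ) (u : Fin m → Γ(Y, U))
      (w : Fin m → ℕ), (∀ i, 0 < w i) ∧ (∀ n, (R.piece n).ideal U = weightedMonomialIdeal u w n) ∧
      ∀ hu : ∀ i, (Y.presheaf.germ (U : Y.Opens) y hy).hom (u i) ∈ maximalIdeal (Y.presheaf.stalk y),
        LinearIndependent (ResidueField (Y.presheaf.stalk y))
          fun i => (maximalIdeal (Y.presheaf.stalk y)).toCotangent ⟨_, hu i⟩) :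
    R.IsRegularWeightedCentre := by
  intro y
  obtain ⟨U, hy, m, u, w, hw, hR, hli⟩ := h y
  haveI := hreg y
  -- restriction of the pieces to an affine sub-open
  have hres : ∀ (V : Y.affineOpens) (hVU : (V : Y.Opens) ≤ U) (n : ℕ), (R.piece n).ideal V =
      weightedMonomialIdeal (fun i => (Y.presheaf.map (homOfLE hVU).op).hom (u i)) w n := by
    intro V hVU n
    rw [← (R.piece n).map_ideal' (U := V) (V := U) (homOfLE hVU).op, hR n, weightedMonomialIdeal_map]
  by_cases hall : ∀ i, (Y.presheaf.germ (U : Y.Opens) y hy).hom (u i) ∈ maximalIdeal (Y.presheaf.stalk y)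
  · -- all parameters vanish at `y`: spread the independence
    obtain ⟨V, hVU, hyV, hchart⟩ :=
      exists_affineOpens_isWeightedChart_of_linearIndependent f U hy u hall (hli hall) w hw
    exact ⟨V, hyV, m, _, w, hchart R (hres V hVU)⟩
  · -- some `u i` is a unit at `y`: the unit chart on `U ∩ D(u i)`
    push Not at hall
    obtain ⟨i, hi⟩ := hall
    have hunit : IsUnit ((Y.presheaf.germ (U : Y.Opens) y hy).hom (u i)) := IsLocalRing.notMem_maximalIdeal.mp hi
    let V : Y.affineOpens := ⟨Y.basicOpen (u i), U.2.basicOpen (u i)⟩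
    have hVU : (V : Y.Opens) ≤ U := Y.basicOpen_le (u i)
    have hyV : y ∈ (V : Y.Opens) := (Scheme.mem_basicOpen Y (u i) y hy).mpr hunit
    have hui : IsUnit ((Y.presheaf.map (homOfLE hVU).op).hom (u i)) := Y.toRingedSpace.isUnit_res_basicOpen (u i)
    refine ⟨V, hyV, 1, fun _ => 1, fun _ => 1, ⟨fun _ => Nat.one_pos, fun n => ?_, ?_⟩⟩
    · rw [ReesAlgebraData.weightedMonomialIdeal_one, hres V hVU n]
      refine Ideal.eq_top_of_isUnit_mem _ ?_ (hui.pow n)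
      have hmem := pow_mem_weightedMonomialIdeal (fun j => (Y.presheaf.map (homOfLE hVU).op).hom (u j)) w
        (self_mem_weightedMonomialIdeal _ w i) n
      exact weightedMonomialIdeal_antitone _ w (Nat.le_mul_of_pos_left n (hw i)) hmem
    · intro y' hy' h1
      exfalso
      have h0 := h1 0
      rw [map_one] at h0
      exact (IsLocalRing.maximalIdeal.isMaximal _).ne_top (Ideal.eq_top_of_isUnit_mem _ h0 isUnit_one)

/-- The same over a SMOOTH `Y → Spec k` (`k` perfect): regularity of the stalks is automatic.
[cite: Wlodarczyk2022, 2.1.10] -/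
theorem isRegularWeightedCentre_of_forall_exists_chart_at_of_smooth {k : Type u} [Field k] [PerfectField k]
    {Y : Scheme.{u}} (f : Y ⟶ Spec (.of k)) [Smooth f] (R : ReesAlgebraData Y)
    (h : ∀ y : Y, ∃ (U : Y.affineOpens) (hy : y ∈ (U : Y.Opens)) (m : ℕ) (u : Fin m → Γ(Y, U))
      (w : Fin m → ℕ), (∀ i, 0 < w i) ∧ (∀ n, (R.piece n).ideal U = weightedMonomialIdeal u w n) ∧
      ∀ hu : ∀ i, (Y.presheaf.germ (U : Y.Opens) y hy).hom (u i) ∈ maximalIdeal (Y.presheaf.stalk y),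
        LinearIndependent (ResidueField (Y.presheaf.stalk y))
          fun i => (maximalIdeal (Y.presheaf.stalk y)).toCotangent ⟨_, hu i⟩) :
    R.IsRegularWeightedCentre :=
  isRegularWeightedCentre_of_forall_exists_chart_at f (fun y => isRegularLocalRing_stalk_of_smooth_of_field f y) R h

end Centre

end Summit.ResolutionOfSingularities.ResolutionOfSingularities.Theorems

end
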